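import Literature.MathematicalPhysics.QuantumLattice.KomaPiFluxGroundStateOrder
import Literature.MathematicalPhysics.QuantumLattice.KomaPiFluxCoulombKLSInequality
import HarnessLib

/-!
# Kubo's inequality for Koma's `π`-flux BCS model: the nearest-neighbour density correlation is
# bounded below by minus the pair correlation (Kennedy–Lieb–Shastry 1988 / Kubo 1988, for Koma 2022)

T. Kennedy, E. H. Lieb, B. S. Shastry, *The XY model has long-range order for all spins and all
dimensions greater than one*, Phys. Rev. Lett. 61 (1988) 2582 [KLS1988PRL], after eq. (4):
"`|e₃| ≤ e₁` (for otherwise the energy could be lowered by interchanging the 1 and 3 spin directions)"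
— K. Kubo, Phys. Rev. Lett. 61 (1988) 110 [Kubo1988PRL]. This is the step that makes the
ground-state (pointwise) infrared bound integrable in two dimensions: the momentum-resolved double
commutator `d e₁ - e₃ Σᵢcos pᵢ` is at most `e₁ Σᵢ(1 + cos pᵢ)` on `{Σcos pᵢ > 0}`.

This file proves the analogue for Koma's `π`-flux BCS pair-hopping lattice fermions
(T. Koma, arXiv:2201.13135 [Koma2022]) in the Lieb frame of this series
(`KomaPiFlux.hamiltonian κ U g 0 0`; `η`-pseudospin `Γ¹, Γ², Γ³` of [Koma2022, (3.1)–(3.10)]):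

* the STAGGERED quarter turn about the `Γ²`-axis, `𝓡 = ∏_x exp(iπ(-1)^x Γ²_x/4)`, written as the
  polynomial `r_x = 1 + (cos(π/4) - 1)P_x + i(-1)^x sin(π/4)Γ²_x` in the doublet projection
  `P_x = (Γ¹_x)²` (`PairHopRP.siteRot`), maps `Γ¹_x ↦ (-1)^xΓ³_x`, `Γ³_x ↦ -(-1)^xΓ¹_x`, fixes `Γ²_x`,
  `P_x` and the on-site `U` term;
* it COMMUTES WITH THE HOPPING `K(T_π)` — Yang's `η`-pairing `SU(2)` [Yang1989, eq. (6)],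
  [EsslerEtAl2005, §2.2.5 (2.80)–(2.84)]: a real
  symmetric bond hopping commutes with the staggered `η`-spin `(Γ²_x - Γ²_y, …)` of the bond
  (`PairHopRP.bondHop_commute_gammaTwo_sub`), and `r_x r_y` (opposite signs on the two sublattices)
  is a polynomial in that staggered `η`-spin (`PairHopRP.siteRot_mul_siteRot_eq`);
* hence `𝓡 H₀ 𝓡ᴴ = H₀ + (g/4) Σ_{x∼y} (Γ³_xΓ³_y + Γ¹_xΓ¹_y)` (`KomaPiFlux.kuboRot_conj_hamiltonian`), and
  the variational principle in the tracial ground state `ω₀` of `H₀` (`E₀(H₀) = E₀(𝓡H₀𝓡ᴴ) ≤ ω₀(𝓡H₀𝓡ᴴ)`)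
  gives **Kubo's inequality** `Σ_μΣ_x Re ω₀(Γ³_xΓ³_{x+e_μ}) ≥ -Σ_μΣ_x Re ω₀(Γ¹_xΓ¹_{x+e_μ})`
  (`KomaPiFlux.kubo_inequality`; `g > 0`, any `κ, U`, even side `L ≥ 4`).

Everything is PROVED; no named fact. [Koma2022] does not state this inequality (his proof, for
`d ≥ 3`, averages the double commutator over momenta); it is the [KLS1988PRL]/[Kubo1988PRL] step
applied to his model, used by the sequel for the two-dimensional ground state.

## References

* [KLS1988PRL] T. Kennedy, E. H. Lieb, B. S. Shastry, Phys. Rev. Lett. 61 (1988) 2582, after eq. (4)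
  (p. 2583: "As Kubo points out, `|e₃| ≤ e₁` (for otherwise the energy could be lowered by interchanging
  the 1 and 3 spin directions)"; reprinted in E. H. Lieb, *Statistical Mechanics (Selecta)*, p. 327ff).
* [Kubo1988PRL] K. Kubo, Phys. Rev. Lett. 61 (1988) 110.
* [Yang1989] C. N. Yang, Phys. Rev. Lett. 63 (1989) 2144, eq. (6) (the `η`-pairing operators commute
  with the real bipartite hopping up to the on-site term).
* [EsslerEtAl2005] F. H. L. Essler, H. Frahm, F. Göhmann, A. Klümper, V. E. Korepin, *The One-Dimensional
  Hubbard Model*, CUP 2005, §2.2.5, eqs. (2.80)–(2.84) (`[H, η^α] = 0`).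
* [Koma2022] T. Koma, arXiv:2201.13135, (3.1)–(3.11), (6.28).
-/

noncomputable section

namespace Literature.MathematicalPhysics.QuantumLattice

open Matrix Finset HubbardWave0 PairHopRP FermionTorus LiebCutRP
open Literature.Probability.LatticeModels
open scoped ComplexOrder

namespace PairHopRP

variable {Λ : Type*} [LinearOrder Λ] [Fintype Λ]

/-! ### The doublet projection `P_x = (Γ¹_x)²` and the `η`-Pauli algebra at one site -/

/-- The projection onto the `η`-doublet at `x` (site empty or doubly occupied): `P_x = (Γ¹_x)² = (Γ²_x)²`.
[cite: Koma2022, (3.7)] -/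
def etaProj (x : Λ) : Matrix (Finset (Orb Λ)) (Finset (Orb Λ)) ℂ := gammaOne x * gammaOne x

/-- `P_x` is Hermitian. [cite: Koma2022, (3.7)] -/
theorem etaProj_isHermitian (x : Λ) : (etaProj x).IsHermitian := by
  rw [etaProj, IsHermitian, conjTranspose_mul, (gammaOne_isHermitian x).eq]

/-- `(Γ²_x)² = P_x`. [cite: Koma2022, (3.7)] -/
theorem gammaTwo_mul_gammaTwo (x : Λ) : gammaTwo x * gammaTwo x = etaProj x := by
  rw [etaProj, gammaOne_sq_eq_gammaTwo_sq]

/-- `P_x Γ⁺_x = Γ⁺_x`. [cite: Koma2022, (3.7)] -/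
theorem etaProj_mul_gammaPlus (x : Λ) : etaProj x * gammaPlus x = gammaPlus x := proj_mul_gammaPlus x

/-- `Γ⁺_x P_x = Γ⁺_x`. [cite: Koma2022, (3.7)] -/
theorem gammaPlus_mul_etaProj (x : Λ) : gammaPlus x * etaProj x = gammaPlus x := gammaPlus_mul_proj x

/-- `P_x Γ⁻_x = Γ⁻_x`. [cite: Koma2022, (3.7)] -/
theorem etaProj_mul_gammaMinus (x : Λ) : etaProj x * gammaMinus x = gammaMinus x := by
  have h := congrArg conjTranspose (gammaPlus_mul_etaProj x)
  rwa [conjTranspose_mul, (etaProj_isHermitian x).eq, conjTranspose_gammaPlus] at h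

/-- `Γ⁻_x P_x = Γ⁻_x`. [cite: Koma2022, (3.7)] -/
theorem gammaMinus_mul_etaProj (x : Λ) : gammaMinus x * etaProj x = gammaMinus x := by
  have h := congrArg conjTranspose (etaProj_mul_gammaPlus x)
  rwa [conjTranspose_mul, (etaProj_isHermitian x).eq, conjTranspose_gammaPlus] at h

/-- `P_x Γ¹_x = Γ¹_x`. [cite: Koma2022, (3.7)] -/
theorem etaProj_mul_gammaOne (x : Λ) : etaProj x * gammaOne x = gammaOne x := by
  rw [gammaOne, Matrix.mul_add, etaProj_mul_gammaPlus, etaProj_mul_gammaMinus]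

/-- `Γ¹_x P_x = Γ¹_x`. [cite: Koma2022, (3.7)] -/
theorem gammaOne_mul_etaProj (x : Λ) : gammaOne x * etaProj x = gammaOne x := by
  rw [gammaOne, Matrix.add_mul, gammaPlus_mul_etaProj, gammaMinus_mul_etaProj]

/-- `P_x Γ²_x = Γ²_x`. [cite: Koma2022, (3.7)] -/
theorem etaProj_mul_gammaTwo (x : Λ) : etaProj x * gammaTwo x = gammaTwo x := by
  rw [gammaTwo, Matrix.mul_smul, Matrix.mul_sub, etaProj_mul_gammaPlus, etaProj_mul_gammaMinus]

/-- `Γ²_x P_x = Γ²_x`. [cite: Koma2022, (3.7)] -/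
theorem gammaTwo_mul_etaProj (x : Λ) : gammaTwo x * etaProj x = gammaTwo x := by
  rw [gammaTwo, Matrix.smul_mul, Matrix.sub_mul, gammaPlus_mul_etaProj, gammaMinus_mul_etaProj]

/-- `P_x² = P_x`. [cite: Koma2022, (3.7)] -/
theorem etaProj_mul_etaProj (x : Λ) : etaProj x * etaProj x = etaProj x := by
  show gammaOne x * gammaOne x * etaProj x = etaProj x
  rw [Matrix.mul_assoc, gammaOne_mul_etaProj, etaProj]

/-- `P_x Γ³_x = Γ³_x` (`Γ³` vanishes off the doublet). [cite: Koma2022, (3.8)–(3.9)] -/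
theorem etaProj_mul_gammaThree (x : Λ) : etaProj x * gammaThree x = gammaThree x := by
  have h : gammaThree x = (-Complex.I) • (gammaOne x * gammaTwo x) := by
    rw [gammaOne_mul_gammaTwo, smul_smul, show -Complex.I * Complex.I = 1 by rw [neg_mul, Complex.I_mul_I, neg_neg],
      one_smul]
  rw [h, Matrix.mul_smul, ← Matrix.mul_assoc, etaProj_mul_gammaOne]

/-- `Γ³_x P_x = Γ³_x`. [cite: Koma2022, (3.8)–(3.9)] -/
theorem gammaThree_mul_etaProj (x : Λ) : gammaThree x * etaProj x = gammaThree x := by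
  have h := congrArg conjTranspose (etaProj_mul_gammaThree x)
  rwa [conjTranspose_mul, (etaProj_isHermitian x).eq, (gammaThree_isHermitian x).eq] at h

/-- `(Γ³_x)² = P_x`. [cite: Koma2022, (3.7), (3.9)] -/
theorem gammaThree_mul_gammaThree (x : Λ) : gammaThree x * gammaThree x = etaProj x := by
  have h1 := one_sub_gammaThree_sq x
  have h2 := KomaPiFlux.one_sub_gammaOne_sq x
  rw [← h2, sub_right_inj] at h1
  rw [h1, etaProj]

/-- `Γ²_xΓ¹_xΓ²_x = -Γ¹_x`. [cite: Koma2022, (3.8)–(3.10)] -/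
theorem gammaTwo_mul_gammaOne_mul_gammaTwo (x : Λ) : gammaTwo x * gammaOne x * gammaTwo x = -gammaOne x := by
  rw [gammaTwo_mul_gammaOne, Matrix.smul_mul, gammaThree_mul_gammaTwo, smul_smul]
  rw [show -Complex.I * -Complex.I = -1 by rw [neg_mul_neg, Complex.I_mul_I], neg_one_smul]

/-- `Γ²_xΓ³_xΓ²_x = -Γ³_x`. [cite: Koma2022, (3.8)–(3.10)] -/
theorem gammaTwo_mul_gammaThree_mul_gammaTwo (x : Λ) : gammaTwo x * gammaThree x * gammaTwo x = -gammaThree x := by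
  rw [gammaTwo_mul_gammaThree, Matrix.smul_mul, gammaOne_mul_gammaTwo, smul_smul, Complex.I_mul_I, neg_one_smul]

/-- `P_x` commutes with `Γ¹_y` (all `y`). [cite: Koma2022, §3] -/
theorem etaProj_comm_gammaOne (x y : Λ) : etaProj x * gammaOne y = gammaOne y * etaProj x := by
  rw [etaProj, Matrix.mul_assoc, gammaOne_comm x y, ← Matrix.mul_assoc, gammaOne_comm x y, Matrix.mul_assoc]

/-- `P_x` commutes with `Γ²_y` (all `y`). [cite: Koma2022, §3] -/
theorem etaProj_comm_gammaTwo (x y : Λ) : etaProj x * gammaTwo y = gammaTwo y * etaProj x := by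
  by_cases hxy : x = y
  · subst hxy; rw [etaProj_mul_gammaTwo, gammaTwo_mul_etaProj]
  · rw [etaProj, Matrix.mul_assoc, gammaOne_comm_gammaTwo_of_ne hxy, ← Matrix.mul_assoc, gammaOne_comm_gammaTwo_of_ne hxy,
      Matrix.mul_assoc]

/-- `P_x` commutes with `Γ³_y` (all `y`). [cite: Koma2022, §3] -/
theorem etaProj_comm_gammaThree (x y : Λ) : etaProj x * gammaThree y = gammaThree y * etaProj x := by
  by_cases hxy : x = y
  · subst hxy; rw [etaProj_mul_gammaThree, gammaThree_mul_etaProj]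
  · rw [etaProj, Matrix.mul_assoc, ← gammaThree_comm_gammaOne_of_ne (Ne.symm hxy), ← Matrix.mul_assoc,
      ← gammaThree_comm_gammaOne_of_ne (Ne.symm hxy), Matrix.mul_assoc]

/-- `P_x` commutes with `P_y`. [cite: Koma2022, §3] -/
theorem etaProj_comm (x y : Λ) : etaProj x * etaProj y = etaProj y * etaProj x := by
  show etaProj x * (gammaOne y * gammaOne y) = gammaOne y * gammaOne y * etaProj x
  rw [← Matrix.mul_assoc, etaProj_comm_gammaOne, Matrix.mul_assoc, etaProj_comm_gammaOne, Matrix.mul_assoc]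

/-! ### The site rotation `r_x = exp(i s π Γ²_x / 4)` as a polynomial -/

/-- `sin(π/4) = cos(π/4) = √2/2`, the coefficient of `iΓ²_x` in `r_x`. [cite: Koma2022, (3.11)] -/
def rotMu : ℝ := Real.sqrt 2 / 2

/-- `cos(π/4) - 1`, the coefficient of `P_x` in `r_x`. [cite: Koma2022, (3.11)] -/
def rotLam : ℝ := rotMu - 1

/-- `(√2/2)² = 1/2`. [folklore] -/
private theorem rotMu_sq : rotMu ^ 2 = 1 / 2 := by
  rw [rotMu, div_pow, Real.sq_sqrt (by norm_num)]; norm_num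

/-- `μ · μ = 1/2`. [folklore] -/
private theorem rotMu_mul_self : rotMu * rotMu = 1 / 2 := by rw [← sq, rotMu_sq]

/-- **The site rotation** `r_x(s) = 1 + λ P_x + i s μ Γ²_x` (`= exp(i s (π/4) Γ²_x)` for `s = ±1`: the
quarter turn of the `η`-spin about the `2`-axis, cf. Koma's (3.11) for the `3`-axis).
[cite: Koma2022, (3.11)] [cite: KLS1988PRL, after eq. (4)] -/
def siteRot (s : ℝ) (x : Λ) : Matrix (Finset (Orb Λ)) (Finset (Orb Λ)) ℂ :=
  1 + (rotLam : ℂ) • etaProj x + (Complex.I * (s * rotMu : ℝ)) • gammaTwo x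

/-- `r_x(s)ᴴ = 1 + λ P_x - i s μ Γ²_x`. [cite: Koma2022, (3.11)] -/
theorem conjTranspose_siteRot (s : ℝ) (x : Λ) :
    (siteRot s x)ᴴ = 1 + (rotLam : ℂ) • etaProj x - (Complex.I * (s * rotMu : ℝ)) • gammaTwo x := by
  rw [siteRot, conjTranspose_add, conjTranspose_add, conjTranspose_one, conjTranspose_smul, conjTranspose_smul,
    (etaProj_isHermitian x).eq, (gammaTwo_isHermitian x).eq]
  simp only [Complex.star_def, Complex.conj_ofReal, map_mul, Complex.conj_I, neg_mul, neg_smul, sub_eq_add_neg]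

section SiteRot

variable {s : ℝ} (hs : s = 1 ∨ s = -1)
include hs

/-- `s² = 1`. [folklore] -/
private theorem sign_sq_eq_one : s * s = 1 := by rcases hs with h | h <;> rw [h] <;> norm_num

/-- **`r r† = 1`.** [cite: Koma2022, (3.11)] -/
theorem siteRot_mul_conjTranspose (x : Λ) : siteRot s x * (siteRot s x)ᴴ = 1 := by
  have hμ := rotMu_mul_self
  rcases hs with rfl | rfl <;>
  · rw [conjTranspose_siteRot, siteRot]
    simp only [Matrix.add_mul, Matrix.mul_add, Matrix.mul_sub, Matrix.one_mul, Matrix.mul_one,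
      Matrix.smul_mul, Matrix.mul_smul, smul_add, smul_smul, 
      etaProj_mul_etaProj, etaProj_mul_gammaTwo,
      gammaTwo_mul_etaProj, 
      gammaTwo_mul_gammaTwo]
    rw [rotLam]
    push_cast
    match_scalars <;> simp only [Complex.ext_iff, Complex.add_re, Complex.add_im, Complex.sub_re, Complex.sub_im,
      Complex.mul_re, Complex.mul_im, Complex.neg_re, Complex.neg_im, Complex.I_re, Complex.I_im, Complex.ofReal_re,
      Complex.ofReal_im, Complex.one_re, Complex.one_im, Complex.zero_re, Complex.zero_im] <;> constructor <;> nlinarith [hμ]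


/-- **`r† r = 1`.** [cite: Koma2022, (3.11)] -/
theorem conjTranspose_mul_siteRot (x : Λ) : (siteRot s x)ᴴ * siteRot s x = 1 :=
  mul_eq_one_comm.1 (siteRot_mul_conjTranspose hs x)

/-- `r` is unitary. [cite: Koma2022, (3.11)] -/
theorem siteRot_mem_unitary (x : Λ) : siteRot s x ∈ unitary (Matrix (Finset (Orb Λ)) (Finset (Orb Λ)) ℂ) :=
  Unitary.mem_iff.2 ⟨by rw [star_eq_conjTranspose]; exact conjTranspose_mul_siteRot hs x,
    by rw [star_eq_conjTranspose]; exact siteRot_mul_conjTranspose hs x⟩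

/-- **`r Γ¹ r† = s Γ³`**: the quarter turn about the `2`-axis takes the `1`-axis to the `3`-axis
(sign `s` on the two sublattices). [cite: Koma2022, (3.11)] [cite: KLS1988PRL, after eq. (4)] -/
theorem siteRot_conj_gammaOne (x : Λ) : siteRot s x * gammaOne x * (siteRot s x)ᴴ = (s : ℂ) • gammaThree x := by
  have hμ := rotMu_mul_self
  rcases hs with rfl | rfl <;>
  · rw [conjTranspose_siteRot, siteRot]
    simp only [Matrix.add_mul, Matrix.mul_add, Matrix.mul_sub, Matrix.one_mul, Matrix.mul_one,
      Matrix.smul_mul, Matrix.mul_smul, smul_add, smul_smul, 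
      etaProj_mul_gammaOne, gammaOne_mul_etaProj, 
      gammaThree_mul_etaProj, gammaOne_mul_gammaTwo, gammaTwo_mul_gammaOne,
      gammaThree_mul_gammaTwo]
    rw [rotLam]
    push_cast
    match_scalars <;> simp only [Complex.ext_iff, Complex.add_re, Complex.add_im, Complex.sub_re, Complex.sub_im,
      Complex.mul_re, Complex.mul_im, Complex.neg_re, Complex.neg_im, Complex.I_re, Complex.I_im, Complex.ofReal_re,
      Complex.ofReal_im, Complex.one_re, Complex.one_im, Complex.zero_re, Complex.zero_im] <;> constructor <;> nlinarith [hμ]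

/-- **`r Γ³ r† = -s Γ¹`.** [cite: Koma2022, (3.11)] [cite: KLS1988PRL, after eq. (4)] -/
theorem siteRot_conj_gammaThree (x : Λ) : siteRot s x * gammaThree x * (siteRot s x)ᴴ = (-s : ℂ) • gammaOne x := by
  have hμ := rotMu_mul_self
  rcases hs with rfl | rfl <;>
  · rw [conjTranspose_siteRot, siteRot]
    simp only [Matrix.add_mul, Matrix.mul_add, Matrix.mul_sub, Matrix.one_mul, Matrix.mul_one,
      Matrix.smul_mul, Matrix.mul_smul, smul_add, smul_smul, 
      gammaOne_mul_etaProj, 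
      etaProj_mul_gammaThree, gammaThree_mul_etaProj, gammaOne_mul_gammaTwo, 
      gammaTwo_mul_gammaThree, gammaThree_mul_gammaTwo]
    rw [rotLam]
    push_cast
    match_scalars <;> simp only [Complex.ext_iff, Complex.add_re, Complex.add_im, Complex.sub_re, Complex.sub_im,
      Complex.mul_re, Complex.mul_im, Complex.neg_re, Complex.neg_im, Complex.I_re, Complex.I_im, Complex.ofReal_re,
      Complex.ofReal_im, Complex.one_re, Complex.one_im, Complex.zero_re, Complex.zero_im] <;> constructor <;> nlinarith [hμ]

/-- **`r Γ² r† = Γ²`** (the rotation is about the `2`-axis). [cite: Koma2022, (3.11)] -/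
theorem siteRot_conj_gammaTwo (x : Λ) : siteRot s x * gammaTwo x * (siteRot s x)ᴴ = gammaTwo x := by
  have hμ := rotMu_mul_self
  rcases hs with rfl | rfl <;>
  · rw [conjTranspose_siteRot, siteRot]
    simp only [Matrix.add_mul, Matrix.mul_add, Matrix.mul_sub, Matrix.one_mul, Matrix.mul_one,
      Matrix.smul_mul, Matrix.mul_smul, smul_add, smul_smul, 
      etaProj_mul_etaProj, etaProj_mul_gammaTwo,
      gammaTwo_mul_etaProj, 
      gammaTwo_mul_gammaTwo]
    rw [rotLam]
    push_cast
    match_scalars <;> simp only [Complex.ext_iff, Complex.add_re, Complex.add_im, Complex.sub_re, Complex.sub_im,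
      Complex.mul_re, Complex.mul_im, Complex.neg_re, Complex.neg_im, Complex.I_re, Complex.I_im, Complex.ofReal_re,
      Complex.ofReal_im, Complex.one_re, Complex.one_im, Complex.zero_re, Complex.zero_im] <;> constructor <;> nlinarith [hμ]

/-- **`r P r† = P`** (the doublet projection is rotation invariant). [cite: Koma2022, (3.7), (3.11)] -/
theorem siteRot_conj_etaProj (x : Λ) : siteRot s x * etaProj x * (siteRot s x)ᴴ = etaProj x := by
  have hμ := rotMu_mul_self
  rcases hs with rfl | rfl <;>
  · rw [conjTranspose_siteRot, siteRot]
    simp only [Matrix.add_mul, Matrix.mul_add, Matrix.mul_sub, Matrix.one_mul, Matrix.mul_one,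
      Matrix.smul_mul, Matrix.mul_smul, smul_add, smul_smul, 
      etaProj_mul_etaProj, etaProj_mul_gammaTwo,
      gammaTwo_mul_etaProj, 
      gammaTwo_mul_gammaTwo]
    rw [rotLam]
    push_cast
    match_scalars <;> simp only [Complex.ext_iff, Complex.add_re, Complex.add_im, Complex.sub_re, Complex.sub_im,
      Complex.mul_re, Complex.mul_im, Complex.neg_re, Complex.neg_im, Complex.I_re, Complex.I_im, Complex.ofReal_re,
      Complex.ofReal_im, Complex.one_re, Complex.one_im, Complex.zero_re, Complex.zero_im] <;> constructor <;> nlinarith [hμ]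

end SiteRot

/-! ### Locality: `r_x` commutes with everything supported away from `x` -/

/-- `r_x` commutes with `Γ¹_y` for `y ≠ x`. [cite: Koma2022, §3] -/
theorem siteRot_comm_gammaOne_of_ne (s : ℝ) {x y : Λ} (hxy : x ≠ y) : Commute (siteRot s x) (gammaOne y) := by
  unfold siteRot
  refine ((Commute.one_left _).add_left (Commute.smul_left ?_ _)).add_left (Commute.smul_left ?_ _)
  · exact etaProj_comm_gammaOne x y
  · exact (gammaOne_comm_gammaTwo_of_ne (Ne.symm hxy)).symm

/-- `r_x` commutes with `Γ²_y` for every `y`. [cite: Koma2022, §3] -/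
theorem siteRot_comm_gammaTwo (s : ℝ) (x y : Λ) : Commute (siteRot s x) (gammaTwo y) := by
  unfold siteRot
  refine ((Commute.one_left _).add_left (Commute.smul_left ?_ _)).add_left (Commute.smul_left ?_ _)
  · exact etaProj_comm_gammaTwo x y
  · exact gammaTwo_comm x y

/-- `r_x` commutes with `Γ³_y` for `y ≠ x`. [cite: Koma2022, §3] -/
theorem siteRot_comm_gammaThree_of_ne (s : ℝ) {x y : Λ} (hxy : x ≠ y) : Commute (siteRot s x) (gammaThree y) := by
  unfold siteRot
  refine ((Commute.one_left _).add_left (Commute.smul_left ?_ _)).add_left (Commute.smul_left ?_ _)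
  · exact etaProj_comm_gammaThree x y
  · exact (gammaThree_comm_gammaTwo_of_ne (Ne.symm hxy)).symm

/-- `r_x` commutes with `P_y` for every `y`. [cite: Koma2022, §3] -/
theorem siteRot_comm_etaProj (s : ℝ) (x y : Λ) : Commute (siteRot s x) (etaProj y) := by
  unfold siteRot
  refine ((Commute.one_left _).add_left (Commute.smul_left ?_ _)).add_left (Commute.smul_left ?_ _)
  · exact etaProj_comm x y
  · exact (etaProj_comm_gammaTwo y x).symm

/-- `r_x` commutes with `r_y` (all `x, y`). [cite: Koma2022, §3] -/
theorem siteRot_comm (s t : ℝ) (x y : Λ) : Commute (siteRot s x) (siteRot t y) := by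
  conv_rhs => unfold siteRot
  refine ((Commute.one_right _).add_right (Commute.smul_right ?_ _)).add_right (Commute.smul_right ?_ _)
  · exact siteRot_comm_etaProj s x y
  · exact siteRot_comm_gammaTwo s x y

/-- `Γ⁺_z` commutes with `c†_i c_j` when `j` is not an orbital of `z`. [cite: Koma2022, (6.25)] -/
theorem gammaPlus_comm_hop {z : Λ} {i j : Orb Λ} (hj0 : orb z 0 ≠ j) (hj1 : orb z 1 ≠ j) :
    gammaPlus z * (creation i * annihilation j) = creation i * annihilation j * gammaPlus z := by
  -- `Γ⁺ = c†_{z0} c†_{z1}`: creators commute with pairs... move through `c†_i` and `c_j`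
  have h1 : gammaPlus z * creation i = creation i * gammaPlus z := by
    rw [gammaPlus, Matrix.mul_assoc, creation_mul_creation_eq_neg (orb z 1) i, Matrix.mul_neg, ← Matrix.mul_assoc,
      creation_mul_creation_eq_neg (orb z 0) i, Matrix.neg_mul, neg_neg, Matrix.mul_assoc]
  have h2 : gammaPlus z * annihilation j = annihilation j * gammaPlus z := by
    have e0 : creation (orb z 0) * annihilation j = -(annihilation j * creation (orb z 0)) := by
      rw [annihilation_mul_creation, if_neg (Ne.symm hj0), zero_sub, neg_neg]
    have e1 : creation (orb z 1) * annihilation j = -(annihilation j * creation (orb z 1)) := by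
      rw [annihilation_mul_creation, if_neg (Ne.symm hj1), zero_sub, neg_neg]
    rw [gammaPlus, Matrix.mul_assoc, e1, Matrix.mul_neg, ← Matrix.mul_assoc, e0, Matrix.neg_mul, neg_neg, Matrix.mul_assoc]
  rw [← Matrix.mul_assoc, h1, Matrix.mul_assoc, h2, ← Matrix.mul_assoc]

/-- `Γ⁻_z` commutes with `c†_i c_j` when `i` is not an orbital of `z`. [cite: Koma2022, (6.25)] -/
theorem gammaMinus_comm_hop {z : Λ} {i j : Orb Λ} (hi0 : orb z 0 ≠ i) (hi1 : orb z 1 ≠ i) :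
    gammaMinus z * (creation i * annihilation j) = creation i * annihilation j * gammaMinus z := by
  have h := congrArg conjTranspose (gammaPlus_comm_hop (i := j) (j := i) hi0 hi1)
  simp only [conjTranspose_mul, conjTranspose_gammaPlus, creation_conjTranspose, annihilation_conjTranspose] at h
  exact h.symm

/-- `Γ¹_z` and `Γ²_z` commute with a hopping term `c†_{uσ} c_{vτ}` between sites `u, v ≠ z`. [cite: Koma2022, (6.25)] -/
theorem gammaOne_comm_hop {z u v : Λ} (hu : u ≠ z) (hv : v ≠ z) (σ τ : Fin 2) :
    gammaOne z * (creation (orb u σ) * annihilation (orb v τ)) = creation (orb u σ) * annihilation (orb v τ) * gammaOne z := by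
  have hu' : ∀ s : Fin 2, orb z s ≠ orb u σ := fun s h => hu (orb_eq_orb_iff.1 h).1.symm
  have hv' : ∀ s : Fin 2, orb z s ≠ orb v τ := fun s h => hv (orb_eq_orb_iff.1 h).1.symm
  rw [gammaOne, Matrix.add_mul, Matrix.mul_add, gammaPlus_comm_hop (hv' 0) (hv' 1), gammaMinus_comm_hop (hu' 0) (hu' 1)]

/-- `Γ²_z` commutes with a hopping term between sites `u, v ≠ z`. [cite: Koma2022, (6.25)] -/
theorem gammaTwo_comm_hop {z u v : Λ} (hu : u ≠ z) (hv : v ≠ z) (σ τ : Fin 2) :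
    gammaTwo z * (creation (orb u σ) * annihilation (orb v τ)) = creation (orb u σ) * annihilation (orb v τ) * gammaTwo z := by
  have hu' : ∀ s : Fin 2, orb z s ≠ orb u σ := fun s h => hu (orb_eq_orb_iff.1 h).1.symm
  have hv' : ∀ s : Fin 2, orb z s ≠ orb v τ := fun s h => hv (orb_eq_orb_iff.1 h).1.symm
  rw [gammaTwo, Matrix.smul_mul, Matrix.mul_smul, Matrix.sub_mul, Matrix.mul_sub, gammaPlus_comm_hop (hv' 0) (hv' 1),
    gammaMinus_comm_hop (hu' 0) (hu' 1)]

/-- `r_z` commutes with a hopping term between sites `u, v ≠ z`. [cite: Koma2022, (6.25)] -/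
theorem siteRot_comm_hop (s : ℝ) {z u v : Λ} (hu : u ≠ z) (hv : v ≠ z) (σ τ : Fin 2) :
    Commute (siteRot s z) (creation (orb u σ) * annihilation (orb v τ)) := by
  unfold siteRot
  refine ((Commute.one_left _).add_left (Commute.smul_left ?_ _)).add_left (Commute.smul_left ?_ _)
  · show etaProj z * _ = _ * etaProj z
    rw [etaProj, Matrix.mul_assoc, gammaOne_comm_hop hu hv, ← Matrix.mul_assoc, gammaOne_comm_hop hu hv, Matrix.mul_assoc]
  · exact gammaTwo_comm_hop hu hv σ τ

/-! ### Yang's `η`-pairing symmetry of a bond -/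

/-- The spin-summed symmetric hopping of the bond `{u, v}`:
`B_{uv} = Σ_σ (c†_{uσ} c_{vσ} + c†_{vσ} c_{uσ})`. [cite: Yang1989, eq. (6)] [cite: EsslerEtAl2005, §2.2.5 eq. (2.84)] -/
def bondHop (u v : Λ) : Matrix (Finset (Orb Λ)) (Finset (Orb Λ)) ℂ :=
  ∑ σ : Fin 2, (creation (orb u σ) * annihilation (orb v σ) + creation (orb v σ) * annihilation (orb u σ))

/-- `B_{uv} = B_{vu}`. [cite: Yang1989, eq. (6)] [cite: EsslerEtAl2005, §2.2.5 eq. (2.84)] -/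
theorem bondHop_comm (u v : Λ) : bondHop u v = bondHop v u := by
  unfold bondHop
  exact Finset.sum_congr rfl fun σ _ => add_comm _ _

/-- `B_{uv}` is Hermitian. [cite: Yang1989, eq. (6)] [cite: EsslerEtAl2005, §2.2.5 eq. (2.84)] -/
theorem conjTranspose_bondHop (u v : Λ) : (bondHop u v)ᴴ = bondHop u v := by
  simp only [bondHop, conjTranspose_sum, conjTranspose_add, conjTranspose_mul, creation_conjTranspose,
    annihilation_conjTranspose]
  exact Finset.sum_congr rfl fun σ _ => add_comm _ _

/-- `[B_{uv}, Γ⁺_u] = c†_{v↑}c†_{u↓} + c†_{u↑}c†_{v↓}` (`u ≠ v`). [cite: Yang1989, eq. (6)] [cite: Koma2022, (6.25)] -/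
theorem bondHop_comm_gammaPlus_left {u v : Λ} (huv : u ≠ v) :
    bondHop u v * gammaPlus u - gammaPlus u * bondHop u v =
      creation (orb v 0) * creation (orb u 1) + creation (orb u 0) * creation (orb v 1) := by
  have e : bondHop u v * gammaPlus u - gammaPlus u * bondHop u v =
      (creation (orb u 0) * annihilation (orb v 0) * gammaPlus u - gammaPlus u * (creation (orb u 0) * annihilation (orb v 0))) +
      (creation (orb v 0) * annihilation (orb u 0) * gammaPlus u - gammaPlus u * (creation (orb v 0) * annihilation (orb u 0))) +
      (creation (orb u 1) * annihilation (orb v 1) * gammaPlus u - gammaPlus u * (creation (orb u 1) * annihilation (orb v 1))) +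
      (creation (orb v 1) * annihilation (orb u 1) * gammaPlus u - gammaPlus u * (creation (orb v 1) * annihilation (orb u 1))) := by
    simp only [bondHop, Fin.sum_univ_two, Matrix.add_mul, Matrix.mul_add]
    abel
  rw [e, hop0_comm_gammaPlus u v u, hop0_comm_gammaPlus v u u, hop1_comm_gammaPlus u v u, hop1_comm_gammaPlus v u u,
    if_neg (Ne.symm huv), if_pos rfl, if_pos rfl, zero_add, add_zero]

/-- `[B_{uv}, Γ⁺_v] = c†_{v↑}c†_{u↓} + c†_{u↑}c†_{v↓} = [B_{uv}, Γ⁺_u]` (`u ≠ v`). [cite: Yang1989, eq. (6)] [cite: EsslerEtAl2005, §2.2.5 eq. (2.84)] -/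
theorem bondHop_comm_gammaPlus_right {u v : Λ} (huv : u ≠ v) :
    bondHop u v * gammaPlus v - gammaPlus v * bondHop u v =
      creation (orb v 0) * creation (orb u 1) + creation (orb u 0) * creation (orb v 1) := by
  rw [bondHop_comm, bondHop_comm_gammaPlus_left (Ne.symm huv), add_comm]

/-- **Yang's `η`-pairing symmetry of a bond**: `[B_{uv}, Γ⁺_u - Γ⁺_v] = 0` — the real symmetric
bond hopping commutes with the staggered pair creation operator. [cite: Yang1989, eq. (6)] [cite: EsslerEtAl2005, §2.2.5 eq. (2.84)] -/
theorem bondHop_commute_gammaPlus_sub {u v : Λ} (huv : u ≠ v) : Commute (bondHop u v) (gammaPlus u - gammaPlus v) := by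
  have h1 := bondHop_comm_gammaPlus_left huv
  have h2 := bondHop_comm_gammaPlus_right huv
  rw [sub_eq_iff_eq_add] at h1 h2
  show bondHop u v * (gammaPlus u - gammaPlus v) = (gammaPlus u - gammaPlus v) * bondHop u v
  rw [Matrix.mul_sub, Matrix.sub_mul, h1, h2]
  abel

/-- `[B_{uv}, Γ⁻_u - Γ⁻_v] = 0`. [cite: Yang1989, eq. (6)] [cite: EsslerEtAl2005, §2.2.5 eq. (2.84)] -/
theorem bondHop_commute_gammaMinus_sub {u v : Λ} (huv : u ≠ v) :
    Commute (bondHop u v) (gammaMinus u - gammaMinus v) := by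
  have h := congrArg conjTranspose (bondHop_commute_gammaPlus_sub huv).eq
  simp only [conjTranspose_mul, conjTranspose_sub, conjTranspose_gammaPlus, conjTranspose_bondHop] at h
  exact h.symm

/-- `[B_{uv}, Γ²_u - Γ²_v] = 0`: the bond hopping commutes with the staggered `2`-component of the
`η`-spin of the bond. [cite: Yang1989, eq. (6)] [cite: EsslerEtAl2005, §2.2.5 eq. (2.84)] [cite: Koma2022, (3.3)] -/
theorem bondHop_commute_gammaTwo_sub {u v : Λ} (huv : u ≠ v) : Commute (bondHop u v) (gammaTwo u - gammaTwo v) := by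
  have e : gammaTwo u - gammaTwo v = Complex.I • ((gammaPlus u - gammaPlus v) - (gammaMinus u - gammaMinus v)) := by
    rw [gammaTwo, gammaTwo, ← smul_sub]
    congr 1
    abel
  rw [e]
  exact ((bondHop_commute_gammaPlus_sub huv).sub_right (bondHop_commute_gammaMinus_sub huv)).smul_right _

/-! ### `r_u(s) r_v(-s)` is a polynomial in `Γ²_u - Γ²_v`, hence commutes with the bond hopping -/

/-- `(Γ²_x)³ = Γ²_x`. [cite: Koma2022, (3.7)–(3.10)] -/
theorem gammaTwo_mul_gammaTwo_mul_gammaTwo (x : Λ) : gammaTwo x * (gammaTwo x * gammaTwo x) = gammaTwo x := by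
  rw [gammaTwo_mul_gammaTwo, gammaTwo_mul_etaProj]

/-- `r_x(s) = 1 + λ (Γ²_x)² + i s μ Γ²_x`. [cite: Koma2022, (3.11)] -/
theorem siteRot_eq_gammaTwo (s : ℝ) (x : Λ) :
    siteRot s x = 1 + (rotLam : ℂ) • (gammaTwo x * gammaTwo x) + (Complex.I * (s * rotMu : ℝ)) • gammaTwo x := by
  rw [siteRot, gammaTwo_mul_gammaTwo]

/-- **`r_u(s) r_v(-s) = p(Γ²_u - Γ²_v)`** for an explicit quartic `p` — the polynomial form of
`e^{isθΓ²_u} e^{-isθΓ²_v} = e^{isθ(Γ²_u - Γ²_v)}`, `θ = π/4`. [cite: Koma2022, (3.11)] [cite: KLS1988PRL, after eq. (4)] -/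
theorem siteRot_mul_siteRot_eq {s : ℝ} (hs : s = 1 ∨ s = -1) (u v : Λ) :
    siteRot s u * siteRot (-s) v =
      1 + (Complex.I * (s * rotMu * (1 - rotLam / 3) : ℝ)) • (gammaTwo u - gammaTwo v)
        - ((rotMu * rotMu / 2 + 2 * (rotLam * rotLam) / 3 : ℝ) : ℂ) • ((gammaTwo u - gammaTwo v) * (gammaTwo u - gammaTwo v))
        + (Complex.I * (s * rotMu * rotLam / 3 : ℝ)) •
            ((gammaTwo u - gammaTwo v) * ((gammaTwo u - gammaTwo v) * (gammaTwo u - gammaTwo v)))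
        + ((rotLam * rotLam / 6 : ℝ) : ℂ) •
            ((gammaTwo u - gammaTwo v) * ((gammaTwo u - gammaTwo v) * ((gammaTwo u - gammaTwo v) * (gammaTwo u - gammaTwo v)))) := by
  have hσ : s * rotMu * (s * rotMu) = 1 / 2 := by
    rw [mul_mul_mul_comm, sign_sq_eq_one hs, one_mul, rotMu_mul_self]
  have hμ : rotMu * rotMu = 1 / 2 := rotMu_mul_self
  have e1 : siteRot (-s) v =
      1 + (rotLam : ℂ) • (gammaTwo v * gammaTwo v) - (Complex.I * (s * rotMu : ℝ)) • gammaTwo v := by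
    rw [siteRot_eq_gammaTwo, sub_eq_add_neg, ← neg_smul]
    congr 2
    push_cast
    ring
  rw [siteRot_eq_gammaTwo s u, e1]
  have ha : gammaTwo u * (gammaTwo u * gammaTwo u) = gammaTwo u := gammaTwo_mul_gammaTwo_mul_gammaTwo u
  have hb : gammaTwo v * (gammaTwo v * gammaTwo v) = gammaTwo v := gammaTwo_mul_gammaTwo_mul_gammaTwo v
  have hab : gammaTwo v * gammaTwo u = gammaTwo u * gammaTwo v := gammaTwo_comm v u
  set a := gammaTwo u
  set b := gammaTwo v
  have ha' : ∀ X : Matrix (Finset (Orb Λ)) (Finset (Orb Λ)) ℂ, a * (a * (a * X)) = a * X := fun X => by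
    rw [← Matrix.mul_assoc a a X, ← Matrix.mul_assoc a (a * a) X, ha]
  have hab' : ∀ X : Matrix (Finset (Orb Λ)) (Finset (Orb Λ)) ℂ, b * (a * X) = a * (b * X) := fun X => by
    rw [← Matrix.mul_assoc, hab, Matrix.mul_assoc]
  simp only [Matrix.add_mul, Matrix.mul_add, Matrix.sub_mul, Matrix.mul_sub, Matrix.one_mul, Matrix.mul_one,
    Matrix.smul_mul, Matrix.mul_smul, smul_add, smul_sub, smul_smul, Matrix.mul_assoc, ha, ha', hb, hab, hab']
  rw [rotLam]
  clear ha' hab' ha hb hab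
  clear_value a b
  match_scalars <;> simp only [Complex.ext_iff, Complex.add_re, Complex.add_im, Complex.sub_re, Complex.sub_im,
    Complex.mul_re, Complex.mul_im, Complex.neg_re, Complex.neg_im, Complex.I_re, Complex.I_im, Complex.ofReal_re,
    Complex.ofReal_im, Complex.one_re, Complex.one_im, Complex.div_ofNat_re,
    Complex.div_ofNat_im, Complex.re_ofNat, Complex.im_ofNat] <;> constructor <;> linarith [hμ, hσ]

/-- **`[B_{uv}, r_u(s) r_v(-s)] = 0`**: the staggered pair rotation of a bond commutes with its
hopping. [cite: Yang1989, eq. (6)] [cite: EsslerEtAl2005, §2.2.5 eq. (2.84)] [cite: KLS1988PRL, after eq. (4)] -/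
theorem bondHop_commute_siteRot_mul_siteRot {s : ℝ} (hs : s = 1 ∨ s = -1) {u v : Λ} (huv : u ≠ v) :
    Commute (bondHop u v) (siteRot s u * siteRot (-s) v) := by
  have hJ := bondHop_commute_gammaTwo_sub huv
  have hJ2 := hJ.mul_right hJ
  have hJ3 := hJ.mul_right hJ2
  have hJ4 := hJ.mul_right hJ3
  rw [siteRot_mul_siteRot_eq hs u v]
  exact ((((Commute.one_right _).add_right (hJ.smul_right _)).sub_right (hJ2.smul_right _)).add_right
    (hJ3.smul_right _)).add_right (hJ4.smul_right _)

/-! ### The staggered global rotation `𝓡 = ∏_x r_x(s_x)` -/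

/-- `(Γ¹_x)² = P_x`. [cite: Koma2022, (3.7)] -/
theorem gammaOne_mul_gammaOne (x : Λ) : gammaOne x * gammaOne x = etaProj x := rfl

/-- `r_x(s)ᴴ = r_x(-s)`. [cite: Koma2022, (3.11)] -/
theorem conjTranspose_siteRot' (s : ℝ) (x : Λ) : (siteRot s x)ᴴ = siteRot (-s) x := by
  rw [conjTranspose_siteRot, siteRot, sub_eq_add_neg, ← neg_smul]
  congr 2
  push_cast
  ring

section Global

variable (G : SimpleGraph Λ) [DecidableRel G.Adj] (s : Λ → ℝ)

/-- Partial products `∏_{z ∈ t} r_z(s_z)` of the (pairwise commuting) site rotations. [cite: KLS1988PRL, after eq. (4)] -/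
def prodRot (t : Finset Λ) : Matrix (Finset (Orb Λ)) (Finset (Orb Λ)) ℂ :=
  t.noncommProd (fun z => siteRot (s z) z) fun x _ y _ _ => siteRot_comm (s x) (s y) x y

/-- **The staggered global `η`-rotation** `𝓡 = ∏_x r_x(s_x)` — KLS's "interchanging the 1 and 3 spin
directions", staggered (`s_x = ±1` alternating along bonds) so as to map Koma's antiferromagnetic
`Γ¹Γ¹` coupling onto the `Γ³Γ³` one. [cite: KLS1988PRL, after eq. (4)] [cite: Koma2022, (3.11)] -/
def kuboRot : Matrix (Finset (Orb Λ)) (Finset (Orb Λ)) ℂ := prodRot s univ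

/-- A partial product commutes with whatever each of its factors commutes with. [cite: KLS1988PRL, after eq. (4)] -/
theorem prodRot_commute_of_forall (t : Finset Λ) {A : Matrix (Finset (Orb Λ)) (Finset (Orb Λ)) ℂ}
    (h : ∀ z ∈ t, Commute (siteRot (s z) z) A) : Commute (prodRot s t) A :=
  (Finset.noncommProd_commute t (fun z => siteRot (s z) z) _ A fun z hz => (h z hz).symm).symm

/-- Splitting off one factor: `(∏_{z ∈ t, z ≠ x} r_z) r_x = ∏_{z ∈ t} r_z`. [cite: KLS1988PRL, after eq. (4)] -/
theorem prodRot_erase_mul {t : Finset Λ} {x : Λ} (hx : x ∈ t) : prodRot s (t.erase x) * siteRot (s x) x = prodRot s t :=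
  Finset.noncommProd_erase_mul t hx (fun z => siteRot (s z) z) _

variable {s} (hs1 : ∀ x, s x = 1 ∨ s x = -1)
include hs1

/-- `(∏ r_z)ᴴ (∏ r_z) = 1`. [cite: KLS1988PRL, after eq. (4)] -/
theorem prodRot_conjTranspose_mul_self (t : Finset Λ) : (prodRot s t)ᴴ * prodRot s t = 1 := by
  induction t using Finset.induction_on with
  | empty => simp [prodRot]
  | insert a t ha ih =>
    rw [prodRot, Finset.noncommProd_insert_of_notMem _ _ _ _ ha, conjTranspose_mul, Matrix.mul_assoc,
      ← Matrix.mul_assoc (siteRot (s a) a)ᴴ, conjTranspose_mul_siteRot (hs1 a), Matrix.one_mul]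
    exact ih

/-- `(∏ r_z) (∏ r_z)ᴴ = 1`. [cite: KLS1988PRL, after eq. (4)] -/
theorem prodRot_mul_conjTranspose (t : Finset Λ) : prodRot s t * (prodRot s t)ᴴ = 1 :=
  mul_eq_one_comm.1 (prodRot_conjTranspose_mul_self hs1 t)

/-- `𝓡ᴴ 𝓡 = 1`. [cite: KLS1988PRL, after eq. (4)] -/
theorem kuboRot_conjTranspose_mul_self : (kuboRot s)ᴴ * kuboRot s = 1 := prodRot_conjTranspose_mul_self hs1 univ

/-- `𝓡 𝓡ᴴ = 1`. [cite: KLS1988PRL, after eq. (4)] -/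
theorem kuboRot_mul_conjTranspose : kuboRot s * (kuboRot s)ᴴ = 1 := prodRot_mul_conjTranspose hs1 univ

/-- `𝓡` is unitary. [cite: KLS1988PRL, after eq. (4)] -/
theorem kuboRot_mem_unitaryGroup : kuboRot s ∈ Matrix.unitaryGroup (Finset (Orb Λ)) ℂ :=
  Matrix.mem_unitaryGroup_iff.2 (by rw [star_eq_conjTranspose]; exact kuboRot_mul_conjTranspose hs1)

/-- Conjugation by `𝓡` acts on an observable at `x` through `r_x` alone. [cite: KLS1988PRL, after eq. (4)] -/
theorem kuboRot_conj_eq_of_local (x : Λ) {A B : Matrix (Finset (Orb Λ)) (Finset (Orb Λ)) ℂ}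
    (hAB : siteRot (s x) x * A * (siteRot (s x) x)ᴴ = B) (hB : ∀ z, z ≠ x → Commute (siteRot (s z) z) B) :
    kuboRot s * A * (kuboRot s)ᴴ = B := by
  have hR : kuboRot s = prodRot s (univ.erase x) * siteRot (s x) x := (prodRot_erase_mul s (mem_univ x)).symm
  have hQ : Commute (prodRot s (univ.erase x)) B :=
    prodRot_commute_of_forall s (univ.erase x) fun z hz => hB z (Finset.ne_of_mem_erase hz)
  rw [hR, conjTranspose_mul]
  calc prodRot s (univ.erase x) * siteRot (s x) x * A * ((siteRot (s x) x)ᴴ * (prodRot s (univ.erase x))ᴴ)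
      = prodRot s (univ.erase x) * (siteRot (s x) x * A * (siteRot (s x) x)ᴴ) * (prodRot s (univ.erase x))ᴴ := by
        simp only [Matrix.mul_assoc]
    _ = B := by rw [hAB, hQ.eq, Matrix.mul_assoc, prodRot_mul_conjTranspose hs1, Matrix.mul_one]

/-- **`𝓡 Γ¹_x 𝓡ᴴ = s_x Γ³_x`.** [cite: KLS1988PRL, after eq. (4)] [cite: Koma2022, (3.11)] -/
theorem kuboRot_conj_gammaOne (x : Λ) : kuboRot s * gammaOne x * (kuboRot s)ᴴ = (s x : ℂ) • gammaThree x :=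
  kuboRot_conj_eq_of_local hs1 x (siteRot_conj_gammaOne (hs1 x) x) fun z hz =>
    (siteRot_comm_gammaThree_of_ne (s z) hz).smul_right _

/-- **`𝓡 Γ³_x 𝓡ᴴ = -s_x Γ¹_x`.** [cite: KLS1988PRL, after eq. (4)] [cite: Koma2022, (3.11)] -/
theorem kuboRot_conj_gammaThree (x : Λ) : kuboRot s * gammaThree x * (kuboRot s)ᴴ = (-s x : ℂ) • gammaOne x :=
  kuboRot_conj_eq_of_local hs1 x (siteRot_conj_gammaThree (hs1 x) x) fun z hz =>
    (siteRot_comm_gammaOne_of_ne (s z) hz).smul_right _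

/-- `𝓡 Γ²_x 𝓡ᴴ = Γ²_x`. [cite: KLS1988PRL, after eq. (4)] [cite: Koma2022, (3.11)] -/
theorem kuboRot_conj_gammaTwo (x : Λ) : kuboRot s * gammaTwo x * (kuboRot s)ᴴ = gammaTwo x :=
  kuboRot_conj_eq_of_local hs1 x (siteRot_conj_gammaTwo (hs1 x) x) fun z _ => siteRot_comm_gammaTwo (s z) z x

/-- `𝓡 P_x 𝓡ᴴ = P_x`. [cite: KLS1988PRL, after eq. (4)] [cite: Koma2022, (3.7)] -/
theorem kuboRot_conj_etaProj (x : Λ) : kuboRot s * etaProj x * (kuboRot s)ᴴ = etaProj x :=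
  kuboRot_conj_eq_of_local hs1 x (siteRot_conj_etaProj (hs1 x) x) fun z _ => siteRot_comm_etaProj (s z) z x

/-- Conjugation is multiplicative: `𝓡 (A B) 𝓡ᴴ = (𝓡 A 𝓡ᴴ)(𝓡 B 𝓡ᴴ)`. [cite: KLS1988PRL, after eq. (4)] -/
theorem kuboRot_conj_mul (A B : Matrix (Finset (Orb Λ)) (Finset (Orb Λ)) ℂ) :
    kuboRot s * (A * B) * (kuboRot s)ᴴ = kuboRot s * A * (kuboRot s)ᴴ * (kuboRot s * B * (kuboRot s)ᴴ) := by
  rw [show kuboRot s * A * (kuboRot s)ᴴ * (kuboRot s * B * (kuboRot s)ᴴ) =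
      kuboRot s * A * ((kuboRot s)ᴴ * kuboRot s) * B * (kuboRot s)ᴴ by simp only [Matrix.mul_assoc],
    kuboRot_conjTranspose_mul_self hs1, Matrix.mul_one, Matrix.mul_assoc (kuboRot s) A B]

/-- **The pair interaction under `𝓡`**: for a bond `x ∼ y` with `s_y = -s_x`,
`𝓡 (g/8){[Γ¹_x - Γ¹_y]² + [Γ²_x - Γ²_y]²} 𝓡ᴴ = (g/8){[Γ³_x + Γ³_y]² + [Γ²_x - Γ²_y]²}`
`= (g/8){[Γ¹_x - Γ¹_y]² + [Γ²_x - Γ²_y]²} + (g/4)(Γ³_xΓ³_y + Γ¹_xΓ¹_y)`. [cite: KLS1988PRL, after eq. (4)] [cite: Koma2022, (3.6)] -/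
theorem kuboRot_conj_bondTerm {x y : Λ} (hsy : s y = -s x) (g : ℝ) :
    kuboRot s * bondTerm g 0 x y * (kuboRot s)ᴴ =
      bondTerm g 0 x y + ((g / 4 : ℝ) : ℂ) • (gammaThree x * gammaThree y + gammaOne x * gammaOne y) := by
  have hss : (s x : ℂ) * (s x : ℂ) = 1 := by rw [← Complex.ofReal_mul, sign_sq_eq_one (hs1 x), Complex.ofReal_one]
  have hD1 : kuboRot s * (gammaOne x - gammaOne y) * (kuboRot s)ᴴ = (s x : ℂ) • (gammaThree x + gammaThree y) := by
    rw [Matrix.mul_sub, Matrix.sub_mul, kuboRot_conj_gammaOne hs1 x, kuboRot_conj_gammaOne hs1 y, hsy,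
      Complex.ofReal_neg, neg_smul, sub_neg_eq_add, smul_add]
  have hD2 : kuboRot s * (gammaTwo x - gammaTwo y) * (kuboRot s)ᴴ = gammaTwo x - gammaTwo y := by
    rw [Matrix.mul_sub, Matrix.sub_mul, kuboRot_conj_gammaTwo hs1 x, kuboRot_conj_gammaTwo hs1 y]
  rw [bondTerm, Complex.ofReal_zero, zero_smul, add_zero, Matrix.mul_smul, Matrix.smul_mul, Matrix.mul_add,
    Matrix.add_mul, kuboRot_conj_mul hs1, kuboRot_conj_mul hs1, hD1, hD2, Matrix.smul_mul, Matrix.mul_smul, smul_smul,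
    hss, one_smul]
  simp only [Matrix.add_mul, Matrix.mul_add, Matrix.sub_mul, Matrix.mul_sub, smul_add, smul_sub,
    gammaThree_mul_gammaThree, gammaOne_mul_gammaOne, (gammaThree_commute y x).eq, gammaOne_comm y x]
  match_scalars <;> ring

/-- **The on-site `U` term is `𝓡`-invariant** (`(n_↑ - ½)(n_↓ - ½) = ½P_x - ¼`). [cite: Koma2022, (6.1)–(6.2)] -/
theorem kuboRot_conj_onSite (x : Λ) :
    kuboRot s * ((numberOp x 0 - (1 / 2 : ℂ) • 1) * (numberOp x 1 - (1 / 2 : ℂ) • 1)) * (kuboRot s)ᴴ =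
      (numberOp x 0 - (1 / 2 : ℂ) • 1) * (numberOp x 1 - (1 / 2 : ℂ) • 1) := by
  have h := KomaPiFlux.gammaOne_mul_self_eq' x
  have hW : (numberOp x 0 - (1 / 2 : ℂ) • 1) * (numberOp x 1 - (1 / 2 : ℂ) • 1) =
      (1 / 2 : ℂ) • etaProj x - (1 / 4 : ℂ) • (1 : Matrix (Finset (Orb Λ)) (Finset (Orb Λ)) ℂ) := by
    rw [etaProj, h]
    module
  rw [hW, Matrix.mul_sub, Matrix.sub_mul, Matrix.mul_smul, Matrix.smul_mul, Matrix.mul_smul, Matrix.smul_mul, Matrix.mul_one,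
    kuboRot_conj_etaProj hs1 x, kuboRot_mul_conjTranspose hs1]

/-- **`𝓡` commutes with the hopping of a bond** `x ∼ y` (`s_y = -s_x`): the factors `r_z`, `z ∉ {x, y}`,
by locality and `r_y r_x` by Yang's `η`-pairing symmetry. [cite: Yang1989, eq. (6)] [cite: EsslerEtAl2005, §2.2.5 eq. (2.84)] [cite: KLS1988PRL, after eq. (4)] -/
theorem kuboRot_commute_bondHop {x y : Λ} (hxy : x ≠ y) (hsy : s y = -s x) : Commute (kuboRot s) (bondHop x y) := by
  have hR : kuboRot s = prodRot s ((univ.erase x).erase y) * (siteRot (s y) y * siteRot (s x) x) := by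
    rw [← Matrix.mul_assoc, prodRot_erase_mul s (Finset.mem_erase.2 ⟨Ne.symm hxy, mem_univ y⟩),
      prodRot_erase_mul s (mem_univ x)]
    rfl
  have hQ : Commute (prodRot s ((univ.erase x).erase y)) (bondHop x y) := by
    refine prodRot_commute_of_forall s _ fun z hz => ?_
    have hzy : z ≠ y := Finset.ne_of_mem_erase hz
    have hzx : z ≠ x := Finset.ne_of_mem_erase (Finset.mem_of_mem_erase hz)
    unfold bondHop
    exact Commute.sum_right _ _ _ fun σ _ =>
      (siteRot_comm_hop (s z) hzx.symm hzy.symm σ σ).add_right (siteRot_comm_hop (s z) hzy.symm hzx.symm σ σ)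
  have hP : Commute (siteRot (s y) y * siteRot (s x) x) (bondHop x y) := by
    have h := (bondHop_commute_siteRot_mul_siteRot (hs1 y) (Ne.symm hxy)).symm
    rw [bondHop_comm y x, show -s y = s x by rw [hsy, neg_neg]] at h
    exact h
  rw [hR]
  exact hQ.mul_left hP

omit hs1 in
/-- Symmetrising the ordered-pair hopping sum: `K + K = Σ_{x,y} [x ∼ y] t_{xy} B_{xy}` for a real
symmetric spin-independent amplitude. [cite: Koma2022, (6.28)] -/
theorem hopSum_add_self (T : Fin 2 → Λ → Λ → ℂ) (hT1 : ∀ x y, T 1 x y = T 0 x y) (hTs : ∀ x y, T 0 y x = T 0 x y) :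
    (∑ x : Λ, ∑ y : Λ, ∑ σ : Fin 2, if G.Adj x y then T σ x y • (creation (orb x σ) * annihilation (orb y σ)) else 0) +
      (∑ x : Λ, ∑ y : Λ, ∑ σ : Fin 2, if G.Adj x y then T σ x y • (creation (orb x σ) * annihilation (orb y σ)) else 0) =
      ∑ x : Λ, ∑ y : Λ, if G.Adj x y then T 0 x y • bondHop x y else 0 := by
  conv_lhs => arg 2; rw [Finset.sum_comm]
  rw [← Finset.sum_add_distrib]
  refine Finset.sum_congr rfl fun x _ => ?_
  rw [← Finset.sum_add_distrib]
  refine Finset.sum_congr rfl fun y _ => ?_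
  by_cases hxy : G.Adj x y
  · simp only [Fin.sum_univ_two, if_pos hxy, if_pos hxy.symm, hT1]
    rw [hTs x y, bondHop, Fin.sum_univ_two]
    simp only [smul_add]
    abel
  · simp only [if_neg hxy, if_neg (fun h => hxy (SimpleGraph.Adj.symm h)), Finset.sum_const_zero, add_zero]

/-- **`𝓡 K(T) 𝓡ᴴ = K(T)`** for a symmetric spin-independent hopping on a graph whose bonds join
opposite signs. [cite: Yang1989, eq. (6)] [cite: EsslerEtAl2005, §2.2.5 eq. (2.84)] [cite: KLS1988PRL, after eq. (4)] -/
theorem kuboRot_conj_hopping (hbip : ∀ x y, G.Adj x y → s y = -s x) (T : Fin 2 → Λ → Λ → ℂ)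
    (hT1 : ∀ x y, T 1 x y = T 0 x y) (hTs : ∀ x y, T 0 y x = T 0 x y) :
    kuboRot s * (∑ x : Λ, ∑ y : Λ, ∑ σ : Fin 2,
        if G.Adj x y then T σ x y • (creation (orb x σ) * annihilation (orb y σ)) else 0) * (kuboRot s)ᴴ =
      ∑ x : Λ, ∑ y : Λ, ∑ σ : Fin 2, if G.Adj x y then T σ x y • (creation (orb x σ) * annihilation (orb y σ)) else 0 := by
  set K := ∑ x : Λ, ∑ y : Λ, ∑ σ : Fin 2,
    if G.Adj x y then T σ x y • (creation (orb x σ) * annihilation (orb y σ)) else 0 with hK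
  have hcomm : Commute (kuboRot s) (K + K) := by
    rw [hK, hopSum_add_self G T hT1 hTs]
    refine Commute.sum_right _ _ _ fun x _ => Commute.sum_right _ _ _ fun y _ => ?_
    by_cases hxy : G.Adj x y
    · rw [if_pos hxy]
      exact (kuboRot_commute_bondHop hs1 (G.ne_of_adj hxy) (hbip x y hxy)).smul_right _
    · rw [if_neg hxy]
      exact Commute.zero_right _
  have h2 : (2 : ℂ) • (kuboRot s * K * (kuboRot s)ᴴ) = (2 : ℂ) • K := by
    rw [two_smul, two_smul, ← Matrix.add_mul, ← Matrix.mul_add, hcomm.eq, Matrix.mul_assoc,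
      kuboRot_mul_conjTranspose hs1, Matrix.mul_one]
  calc kuboRot s * K * (kuboRot s)ᴴ = (2 : ℂ)⁻¹ • ((2 : ℂ) • (kuboRot s * K * (kuboRot s)ᴴ)) := by
        rw [smul_smul, inv_mul_cancel₀ two_ne_zero, one_smul]
    _ = K := by rw [h2, smul_smul, inv_mul_cancel₀ two_ne_zero, one_smul]

/-- **`𝓡 H 𝓡ᴴ = H + (g/4) Σ_{x,y: x∼y} (Γ³_xΓ³_y + Γ¹_xΓ¹_y)`** for the sourceless pair-hopping
Hamiltonian `H = K(T) + U Σ(n-½)(n-½) + H_pair(g, 0)` with a symmetric spin-independent hopping on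
a graph whose bonds join opposite signs `s_y = -s_x`. [cite: KLS1988PRL, after eq. (4)] [cite: Koma2022, (3.6), (6.1)] -/
theorem kuboRot_conj_hamiltonian (hbip : ∀ x y, G.Adj x y → s y = -s x) (T : Fin 2 → Λ → Λ → ℂ)
    (hT1 : ∀ x y, T 1 x y = T 0 x y) (hTs : ∀ x y, T 0 y x = T 0 x y) (U g : ℝ) :
    kuboRot s * hamiltonian G T U g (fun _ _ => 0) 0 * (kuboRot s)ᴴ =
      hamiltonian G T U g (fun _ _ => 0) 0 +
        ((g / 4 : ℝ) : ℂ) • ∑ x : Λ, ∑ y : Λ, if G.Adj x y then gammaThree x * gammaThree y + gammaOne x * gammaOne y else 0 := by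
  have hK := kuboRot_conj_hopping G hs1 hbip T hT1 hTs
  have hW : kuboRot s * (∑ x : Λ, (numberOp x 0 - (1 / 2 : ℂ) • 1) * (numberOp x 1 - (1 / 2 : ℂ) • 1)) * (kuboRot s)ᴴ =
      ∑ x : Λ, (numberOp x 0 - (1 / 2 : ℂ) • 1) * (numberOp x 1 - (1 / 2 : ℂ) • 1) := by
    rw [Finset.mul_sum, Finset.sum_mul]
    exact Finset.sum_congr rfl fun x _ => kuboRot_conj_onSite hs1 x
  have hP : kuboRot s * pairInteraction G g (fun _ _ => 0) * (kuboRot s)ᴴ =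
      pairInteraction G g (fun _ _ => 0) +
        ((g / 4 : ℝ) : ℂ) • ∑ x : Λ, ∑ y : Λ, if G.Adj x y then gammaThree x * gammaThree y + gammaOne x * gammaOne y else 0 := by
    rw [pairInteraction, Finset.mul_sum, Finset.sum_mul, Finset.smul_sum, ← Finset.sum_add_distrib]
    refine Finset.sum_congr rfl fun x _ => ?_
    rw [Finset.mul_sum, Finset.sum_mul, Finset.smul_sum, ← Finset.sum_add_distrib]
    refine Finset.sum_congr rfl fun y _ => ?_
    by_cases hxy : G.Adj x y
    · rw [if_pos hxy, if_pos hxy]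
      exact kuboRot_conj_bondTerm hs1 (hbip x y hxy) g
    · rw [if_neg hxy, if_neg hxy, Matrix.mul_zero, Matrix.zero_mul, smul_zero, add_zero]
  rw [PairHopRP.hamiltonian, peierlsHubbard, Complex.ofReal_zero, zero_smul, sub_zero, Matrix.mul_add, Matrix.add_mul,
    Matrix.mul_add, Matrix.add_mul, Matrix.mul_neg, Matrix.neg_mul, hK, Matrix.mul_smul, Matrix.smul_mul, hW, hP]
  abel

/-- **Kubo's inequality (abstract form)**: in the tracial ground state `ω₀` of `H`,
`Σ_{x,y: x∼y} [Re ω₀(Γ³_xΓ³_y) + Re ω₀(Γ¹_xΓ¹_y)] ≥ 0` for `g > 0` — "otherwise the energy could be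
lowered by interchanging the 1 and 3 spin directions": `E₀ = E₀(𝓡H𝓡ᴴ) ≤ ω₀(𝓡H𝓡ᴴ) = E₀ + (g/4)Σ(…)`.
[cite: KLS1988PRL, after eq. (4)] [cite: Kubo1988PRL] -/
theorem kubo_sum_adj_nonneg (hbip : ∀ x y, G.Adj x y → s y = -s x) (T : Fin 2 → Λ → Λ → ℂ)
    (hT1 : ∀ x y, T 1 x y = T 0 x y) (hTs : ∀ x y, T 0 y x = T 0 x y) (hTh : ∀ σ x y, T σ y x = star (T σ x y))
    (U : ℝ) {g : ℝ} (hg : 0 < g) :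
    0 ≤ ∑ x : Λ, ∑ y : Λ, if G.Adj x y then
      ((hamiltonian G T U g (fun _ _ => 0) 0).groundStateFunctional (gammaThree x * gammaThree y)).re +
        ((hamiltonian G T U g (fun _ _ => 0) 0).groundStateFunctional (gammaOne x * gammaOne y)).re else 0 := by
  set H := hamiltonian G T U g (fun _ _ => 0) 0 with hH
  have hHh : H.IsHermitian := hamiltonian_isHermitian G T hTh U g _ 0
  have h1 : (kuboRot s * H * (kuboRot s)ᴴ).groundEnergy = H.groundEnergy :=
    Matrix.groundEnergy_unitary_conj (kuboRot_mem_unitaryGroup hs1)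
  have h2 := groundEnergy_le_groundStateFunctional_re hHh (Matrix.isHermitian_mul_mul_conjTranspose (kuboRot s) hHh)
  rw [h1, hH, kuboRot_conj_hamiltonian G hs1 hbip T hT1 hTs U g, ← hH, map_add, groundStateFunctional_hamiltonian hHh,
    map_smul, Complex.add_re, Complex.ofReal_re, smul_eq_mul, Complex.re_ofReal_mul] at h2
  have h3 : 0 ≤ (H.groundStateFunctional
      (∑ x : Λ, ∑ y : Λ, if G.Adj x y then gammaThree x * gammaThree y + gammaOne x * gammaOne y else 0)).re :=
    (mul_nonneg_iff_of_pos_left (by positivity : (0 : ℝ) < g / 4)).1 (by linarith)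
  have h4 : (H.groundStateFunctional
      (∑ x : Λ, ∑ y : Λ, if G.Adj x y then gammaThree x * gammaThree y + gammaOne x * gammaOne y else 0)).re =
      ∑ x : Λ, ∑ y : Λ, if G.Adj x y then
        (H.groundStateFunctional (gammaThree x * gammaThree y)).re +
          (H.groundStateFunctional (gammaOne x * gammaOne y)).re else 0 := by
    rw [map_sum, Complex.re_sum]
    refine Finset.sum_congr rfl fun x _ => ?_
    rw [map_sum, Complex.re_sum]
    refine Finset.sum_congr rfl fun y _ => ?_
    split_ifs
    · rw [map_add, Complex.add_re]
    · rw [map_zero, Complex.zero_re]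
  rw [h4] at h3
  exact h3

end Global

end PairHopRP

/-! ### Koma's `π`-flux model on the even torus -/

namespace KomaPiFlux

attribute [local instance] LiebCutRP.decEqTorus

variable {d L : ℕ} [NeZero L]

/-- The torus graph is bipartite for the staggered sign: `x ∼ y ⟹ (-1)^y = -(-1)^x` (`L` even).
[cite: Koma2022, (2.5)] -/
theorem stagSign_adj (hL : Even L) (h2 : 2 ≤ L) {x y : FermionTorus (d + 1) L} (hxy : (G d L).Adj x y) :
    stagSign y = -stagSign x := by
  rcases (adj_iff_shift_or_unshift h2 x y).1 hxy with ⟨μ, rfl⟩ | ⟨μ, rfl⟩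
  · exact stagSign_shift hL x μ
  · have h := stagSign_shift hL (unshift x μ) μ
    rw [shift_unshift] at h
    linarith

/-- **`𝓡 H₀ 𝓡ᴴ = H₀ + (g/4) Σ_{x,y: x∼y} (Γ³_xΓ³_y + Γ¹_xΓ¹_y)`** for Koma's sourceless `π`-flux
Hamiltonian `H₀ = H(κ, U; g, 0; 0)` in the Lieb frame, `𝓡 = ∏_x r_x((-1)^x)`. [cite: KLS1988PRL, after eq. (4)]
[cite: Koma2022, (2.4)–(2.9), (3.11)] -/
theorem kuboRot_conj_hamiltonian (hL : Even L) (h2 : 2 ≤ L) (κ U g : ℝ) :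
    PairHopRP.kuboRot stagSign * hamiltonian κ U g (fun _ _ => 0) 0 * (PairHopRP.kuboRot stagSign)ᴴ =
      hamiltonian κ U g (fun _ _ => 0) 0 + ((g / 4 : ℝ) : ℂ) • ∑ x : FermionTorus (d + 1) L, ∑ y : FermionTorus (d + 1) L,
        if (G d L).Adj x y then gammaThree x * gammaThree y + gammaOne x * gammaOne y else 0 := by
  unfold hamiltonian
  exact PairHopRP.kuboRot_conj_hamiltonian (G d L) stagSign_eq_or (fun _ _ hxy => stagSign_adj hL h2 hxy) (piFluxAmpl κ)
    (fun _ _ => rfl) (fun x y => piFluxAmpl_symm κ 0 x y) U g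

/-- **Kubo's inequality for Koma's `π`-flux BCS model at zero temperature**: in the tracial ground
state `ω₀` of `H₀ = H(κ, U; g, 0; 0)` (`g > 0`, even side `L ≥ 4`),
`-Σ_μ Σ_x Re ω₀(Γ¹_x Γ¹_{x+e_μ}) ≤ Σ_μ Σ_x Re ω₀(Γ³_x Γ³_{x+e_μ})` — the nearest-neighbour `3`-`3`
(density–density) correlation is at least minus the `1`-`1` (pair–pair) one, "for otherwise the
energy could be lowered by interchanging the 1 and 3 spin directions". [cite: KLS1988PRL, after eq. (4)]
[cite: Kubo1988PRL] [cite: Koma2022, (3.11), (6.28)] -/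
theorem kubo_inequality (hL : Even L) (h3 : 3 ≤ L) (κ U : ℝ) {g : ℝ} (hg : 0 < g) :
    -(∑ μ : Fin (d + 1), ∑ x : FermionTorus (d + 1) L,
        ((hamiltonian κ U g (fun _ _ => 0) 0).groundStateFunctional (gammaOne x * gammaOne (shift x μ))).re) ≤
      ∑ μ : Fin (d + 1), ∑ x : FermionTorus (d + 1) L,
        ((hamiltonian κ U g (fun _ _ => 0) 0).groundStateFunctional (gammaThree x * gammaThree (shift x μ))).re := by
  have h2 : 2 ≤ L := by omega
  unfold hamiltonian
  have h := PairHopRP.kubo_sum_adj_nonneg (G d L) stagSign_eq_or (fun _ _ hxy => stagSign_adj hL h2 hxy) (piFluxAmpl κ)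
    (fun _ _ => rfl) (fun x y => piFluxAmpl_symm κ 0 x y) (piFluxAmpl_herm κ) U hg
  set ω := (PairHopRP.hamiltonian (G d L) (piFluxAmpl κ) U g (fun (_ _ : FermionTorus (d + 1) L) => (0 : ℝ)) 0).groundStateFunctional
    with hω
  have h' : 0 ≤ ∑ x : FermionTorus (d + 1) L, ∑ μ : Fin (d + 1),
      (((ω (gammaThree x * gammaThree (shift x μ))).re + (ω (gammaOne x * gammaOne (shift x μ))).re) +
        ((ω (gammaThree (shift x μ) * gammaThree x)).re + (ω (gammaOne (shift x μ) * gammaOne x)).re)) := by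
    rw [sum_shift_add_sum_shift_swap h3
      (fun x y => (ω (gammaThree x * gammaThree y)).re + (ω (gammaOne x * gammaOne y)).re)]
    convert h
  have e : ∀ (x : FermionTorus (d + 1) L) (μ : Fin (d + 1)),
      (ω (gammaThree (shift x μ) * gammaThree x)).re + (ω (gammaOne (shift x μ) * gammaOne x)).re =
        (ω (gammaThree x * gammaThree (shift x μ))).re + (ω (gammaOne x * gammaOne (shift x μ))).re := fun x μ => by
    rw [(gammaThree_commute (shift x μ) x).eq, gammaOne_comm (shift x μ) x]
  simp only [e, Finset.sum_add_distrib] at h'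
  rw [Finset.sum_comm, Finset.sum_comm (f := fun x μ => (ω (gammaOne x * gammaOne (shift x μ))).re)] at h'
  have h' : ∑ μ : Fin (d + 1), ∑ x : FermionTorus (d + 1) L,
      ((ω (gammaThree x * gammaThree (shift x μ))).re + (ω (gammaOne x * gammaOne (shift x μ))).re) =
      (∑ μ : Fin (d + 1), ∑ x : FermionTorus (d + 1) L, (ω (gammaThree x * gammaThree (shift x μ))).re) +
        ∑ μ : Fin (d + 1), ∑ x : FermionTorus (d + 1) L, (ω (gammaOne x * gammaOne (shift x μ))).re := by
    simp only [Finset.sum_add_distrib]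
  linarith

end KomaPiFlux




end Literature.MathematicalPhysics.QuantumLattice

end
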